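import Summits.AnomalousDissipation.AnomalousDissipation.Theorems.SawtoothPulseCascadeK1LocalisedCascadeSlotWienerBound
import Summits.AnomalousDissipation.AnomalousDissipation.Theorems.SawtoothPulseCascadeK1LocalisedCascadeSlotMultiplierData
import Summits.AnomalousDissipation.AnomalousDissipation.Theorems.SawtoothPulseCascadeK1LocalisedCascadeSmoothLeakage
import Summits.AnomalousDissipation.AnomalousDissipation.Theorems.SawtoothPulseCascadeK1LocalisedCascadeMultiplierConstants

/-!
# K1loc, line `Spectral` / SeqCone — helper: FIRST-ORDER SPECTRAL MOMENTS OF THE UNMODULATED CUT-OFFS (S-B → LedgerGlue)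

Helper file of the prover lane on the crux `K1LocalisedCascade` (stmt-AnomalousDissipation-19491), route
`SawtoothPulseCascade` (glue seat k1loc-p3; socket (b) of ad-k1loc-p2's `…LedgerGlue.ledger_step_H_of_moduli`).  That
theorem charges each half-slot with the `ℓ¹` spectral moments `Σ_q ω(q)‖𝓕(X̃^σ ∘ x_j)(q)‖`, `Σ_q ω₂(q)‖𝓕(X^± ∘ x_j)(q)‖` of
the UNMODULATED strip cut-offs against moduli `ω`, `ω₂` of the symbols `μ`, `m²`.  This file closes them from two derivatives:
* `tsum_abs_mul_norm_mFourierCoeff_le` — **Sobolev–Wiener on one axis**: for a family `Θ_α` with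
  `𝓕Θ_α(q) = (2πi q_j)^α 𝓕Θ_0(q)`, `𝓕Θ_0` supported on the `e_j`-axis and `‖Θ_2‖ ≤ B`:
  `Σ_q |q_j|·‖𝓕Θ_0(q)‖ ≤ B/(4π√3)` (Cauchy–Schwarz against `Σ_{m≠0} m⁻² = π²/3` and Parseval) — one derivative less than
  `…SlotWienerBound` (which needs `Θ_3`);
* `tsum_abs_mul_norm_mFourierCoeff_onCircle_le` — for a profile `X : ShearProfile` read off `x_j`:
  `Σ_q |q_j|·‖𝓕(x ↦ X(x_j))(q)‖ ≤ (sup|X″|)/(4π√3)`;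
* `abs_sub_le_of_fibre_deriv` / `modulus_of_fibre_lipschitz` — a symbol that is `ω₁`-Lipschitz along the `j`-fibres has the
  lattice modulus `ω(q) = ω₁|q_j|` on the axis (and `2M₀` off it);
* `tsum_modulus_mul_norm_mFourierCoeff_onCircle_le` — hence `Σ_q ω(q)‖𝓕(x ↦ X(x_j))(q)‖ ≤ ω₁·(sup|X″|)/(4π√3)` with the
  summability `hωp/hωm/hω2p/hω2s` of `ledger_step_H_of_moduli`; `onCircle_add` for the carrier `X⁺ + X⁻`.
With `…MultiplierConstants.abs_iteratedDeriv_cutoff_deriv_U_le` (`k = 2`) and the fibre Taylor data of `…SymbolFibreDataH`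
(`r = 1`) every first-order moment of the ledger is an explicit number.  No definitions; no statement about the stub.
[cite: Grafakos2014, Prop. 3.1.2 (5) and Prop. 3.2.7 (3)] [problem: turb]
-/

-- `Summit.<Summit>.<Problem>`: single-conjunct summit, the duplicate namespace segment is deliberate.
set_option linter.dupNamespace false

noncomputable section

namespace Summit.AnomalousDissipation.AnomalousDissipation.Theorems.SawtoothPulseCascade.K1Slot

open MeasureTheory Set Filter Topology UnitAddTorus Complex
open Literature.Analysis Literature.Analysis.FunctionSpaces Literature.Analysis.FunctionSpaces.Torus
open Summit.AnomalousDissipation.AnomalousDissipation.Theorems.SawtoothPulseCascade.SpectralLeakage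
open Summit.AnomalousDissipation.AnomalousDissipation.Theorems.SawtoothPulseCascade.K1Cutoff
open scoped ContDiff

variable {d : Type*} [Fintype d] [DecidableEq d]

/-! ## Sobolev–Wiener on one axis -/

omit [DecidableEq d] in
/-- **Sobolev–Wiener inequality on one axis.**  Let `Θ_α : T^d → ℂ` satisfy `𝓕Θ_α(q) = (2πi q_j)^α 𝓕Θ_0(q)`, with `𝓕Θ_0`
supported on the `e_j`-axis, `Θ_2` continuous and `‖Θ_2‖ ≤ B`.  Then `q ↦ |q_j|·‖𝓕Θ_0(q)‖` is summable and
`Σ_q |q_j|·‖𝓕Θ_0(q)‖ ≤ B/(4π√3)`  (`= (2π)⁻² Σ_{q_j ≠ 0} ‖𝓕Θ_2(q)‖/|q_j| ≤ (2π)⁻² (π/√3)‖Θ_2‖_{L²}`).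
[cite: Grafakos2014, Prop. 3.1.2 (5) and Prop. 3.2.7 (3)] -/
theorem tsum_abs_mul_norm_mFourierCoeff_le {Θ : ℕ → UnitAddTorus d → ℂ} (j : d)
    (hrel : ∀ α q, mFourierCoeff (Θ α) q = (2 * Real.pi * I * (q j : ℂ)) ^ α * mFourierCoeff (Θ 0) q)
    (haxis : ∀ (q : d → ℤ) (l : d), l ≠ j → q l ≠ 0 → mFourierCoeff (Θ 0) q = 0) (hΘ2 : Continuous (Θ 2)) {B : ℝ}
    (hB : ∀ x, ‖Θ 2 x‖ ≤ B) :
    (Summable fun q : d → ℤ => |(q j : ℝ)| * ‖mFourierCoeff (Θ 0) q‖) ∧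
    ∑' q : d → ℤ, |(q j : ℝ)| * ‖mFourierCoeff (Θ 0) q‖ ≤ B / (4 * Real.pi * Real.sqrt 3) := by
  classical
  have hB0 : 0 ≤ B := (norm_nonneg _).trans (hB 0)
  have h2π : 0 < 2 * Real.pi := by positivity
  -- Parseval for `Θ 2` and the bound `∫‖Θ 2‖² ≤ B²`
  have hPars := hasSum_sq_mFourierCoeff_of_continuous hΘ2
  have hL2 : ∫ x, ‖Θ 2 x‖ ^ 2 ≤ B ^ 2 := by
    have h := integral_mono_of_nonneg (μ := (volume : Measure (UnitAddTorus d))) (f := fun x => ‖Θ 2 x‖ ^ 2)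
      (g := fun _ => B ^ 2) (Eventually.of_forall fun x => by positivity) (integrable_const _)
      (Eventually.of_forall fun x => pow_le_pow_left₀ (norm_nonneg _) (hB x) 2)
    simpa using h
  -- the three families of the weighted Cauchy–Schwarz
  set r : (d → ℤ) → ℝ := fun q => (2 * Real.pi) ^ 2 * (|(q j : ℝ)| * ‖mFourierCoeff (Θ 0) q‖) with hr
  set f : (d → ℤ) → ℝ := fun q => if (∀ l, l ≠ j → q l = 0) then 1 / ((q j : ℝ)) ^ 2 else 0 with hf
  set g : (d → ℤ) → ℝ := fun q => ‖mFourierCoeff (Θ 2) q‖ ^ 2 with hg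
  have hr0 : ∀ q, 0 ≤ r q := fun q => by positivity
  have hf0 : ∀ q, 0 ≤ f q := fun q => by rw [hf]; simp only; split_ifs <;> positivity
  have hg0 : ∀ q, 0 ≤ g q := fun q => by positivity
  -- `f` is summable with sum `π²/3` (the axis copy of `Σ 1/m²`)
  have hinj : Function.Injective (fun m : ℤ => (Pi.single j m : d → ℤ)) := fun a b h => by simpa using congrFun h j
  have hsupp : Function.support f ⊆ Set.range (fun m : ℤ => (Pi.single j m : d → ℤ)) := by
    intro q hq
    rw [Function.mem_support, hf] at hq
    simp only [ne_eq, ite_eq_right_iff, Classical.not_imp] at hq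
    refine ⟨q j, ?_⟩
    funext l
    by_cases hl : l = j
    · subst hl; simp
    · show (Pi.single j (q j) : d → ℤ) l = q l
      rw [Pi.single_eq_of_ne (M := fun _ : d => ℤ) hl, hq.1 l hl]
  have hcomp : (f ∘ fun m : ℤ => (Pi.single j m : d → ℤ)) = fun m : ℤ => (1 : ℝ) / (m : ℝ) ^ 2 := by
    funext m
    simp only [Function.comp_apply, hf, Pi.single_eq_same]
    rw [if_pos (show ∀ l : d, l ≠ j → (Pi.single j m : d → ℤ) l = 0 from
      fun l hl => Pi.single_eq_of_ne (M := fun _ : d => ℤ) hl m)]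
  have hsupp' : ∀ x, x ∉ Set.range (fun m : ℤ => (Pi.single j m : d → ℤ)) → f x = 0 := fun x hx =>
    Function.notMem_support.mp fun h => hx (hsupp h)
  have hfs : Summable f := (hinj.summable_iff hsupp').mp (by rw [hcomp]; exact hasSum_one_div_int_sq.summable)
  have hfsum : ∑' q, f q = Real.pi ^ 2 / 3 := by
    rw [← hinj.tsum_eq hsupp, show (fun m : ℤ => f (Pi.single j m)) = f ∘ fun m : ℤ => (Pi.single j m : d → ℤ) from rfl,
      hcomp, hasSum_one_div_int_sq.tsum_eq]
  -- termwise `r² ≤ f·g`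
  have hrfg : ∀ q, r q ^ 2 ≤ f q * g q := by
    intro q
    by_cases hq : ∀ l, l ≠ j → q l = 0
    · by_cases hqj : q j = 0
      · have : r q = 0 := by rw [hr]; simp [hqj]
        rw [this]; simpa using mul_nonneg (hf0 q) (hg0 q)
      · -- on the axis: `(2π)²|q_j|‖𝓕Θ₀‖ = ‖𝓕Θ₂‖/|q_j|`
        have hne : (2 * Real.pi * I * (q j : ℂ)) ^ 2 ≠ 0 := by
          apply pow_ne_zero; simp [Real.pi_ne_zero, Complex.I_ne_zero, hqj]
        have heq : mFourierCoeff (Θ 0) q = mFourierCoeff (Θ 2) q / (2 * Real.pi * I * (q j : ℂ)) ^ 2 := by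
          rw [hrel 2 q, mul_div_cancel_left₀ _ hne]
        have hn : ‖(2 * Real.pi * I * (q j : ℂ))‖ = 2 * Real.pi * |(q j : ℝ)| := by
          rw [norm_mul, norm_mul, norm_mul, Complex.norm_I, mul_one, Complex.norm_intCast, Complex.norm_real,
            Complex.norm_ofNat, Real.norm_eq_abs, abs_of_pos Real.pi_pos]
        have hqpos : 0 < |(q j : ℝ)| := abs_pos.mpr (by exact_mod_cast hqj)
        have hrq : r q = ‖mFourierCoeff (Θ 2) q‖ / |(q j : ℝ)| := by
          rw [hr]; simp only
          rw [heq, norm_div, norm_pow, hn]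
          field_simp
        rw [hrq, hg]
        simp only [hf, if_pos hq, div_pow, sq_abs, one_div]
        exact le_of_eq (by ring)
    · push Not at hq
      obtain ⟨l, hl, hql⟩ := hq
      have : r q = 0 := by rw [hr]; simp [haxis q l hl hql]
      rw [this]; simpa using mul_nonneg (hf0 q) (hg0 q)
  obtain ⟨hrs, hCS⟩ := tsum_sq_le_tsum_mul_tsum hr0 hf0 hg0 hfs hPars.summable hrfg
  rw [hfsum, hPars.tsum_eq] at hCS
  -- `Σ r ≤ π B/√3`
  have hsum_r : ∑' q, r q ≤ Real.pi * B / Real.sqrt 3 := by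
    have h3 : 0 < Real.sqrt 3 := Real.sqrt_pos.mpr (by norm_num)
    have hsq : (∑' q, r q) ^ 2 ≤ (Real.pi * B / Real.sqrt 3) ^ 2 := by
      calc (∑' q, r q) ^ 2 ≤ Real.pi ^ 2 / 3 * ∫ x, ‖Θ 2 x‖ ^ 2 := hCS
        _ ≤ Real.pi ^ 2 / 3 * B ^ 2 := mul_le_mul_of_nonneg_left hL2 (by positivity)
        _ = (Real.pi * B / Real.sqrt 3) ^ 2 := by
            rw [div_pow, mul_pow, Real.sq_sqrt (by norm_num : (0 : ℝ) ≤ 3)]; ring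
    exact (pow_le_pow_iff_left₀ (tsum_nonneg hr0) (by positivity) two_ne_zero).mp hsq
  -- unscale by `(2π)²`
  have hscale : (fun q : d → ℤ => |(q j : ℝ)| * ‖mFourierCoeff (Θ 0) q‖) = fun q => ((2 * Real.pi) ^ 2)⁻¹ * r q := by
    funext q; rw [hr]; simp only; field_simp
  rw [hscale]
  refine ⟨hrs.mul_left _, ?_⟩
  rw [tsum_mul_left]
  have h3 : 0 < Real.sqrt 3 := Real.sqrt_pos.mpr (by norm_num)
  calc ((2 * Real.pi) ^ 2)⁻¹ * ∑' q, r q ≤ ((2 * Real.pi) ^ 2)⁻¹ * (Real.pi * B / Real.sqrt 3) :=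
        mul_le_mul_of_nonneg_left hsum_r (by positivity)
    _ = B / (4 * Real.pi * Real.sqrt 3) := by field_simp; ring

/-! ## Profiles read off one coordinate -/

/-- The circle function of a periodic `F` that is the complex cast of a real profile `X` agrees with the cast of
`X.onCircle`. [folklore] -/
theorem periodicLift_ofReal_eq_onCircle (X : ShearProfile) {F : ℝ → ℂ} (hp : Function.Periodic F 1)
    (hF : ∀ y, F y = (X y : ℂ)) (b : UnitAddCircle) : (hp.lift : UnitAddCircle → ℂ) b = ((X.onCircle b : ℝ) : ℂ) := by
  induction b using QuotientAddGroup.induction_on with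
  | H y => rw [hp.lift_coe, ShearProfile.onCircle_coe, hF]

omit [DecidableEq d] in
/-- The coefficients of `x ↦ X(x_j)` vanish off the `e_j`-axis. [cite: Grafakos2014, Prop. 3.1.2 (5)] -/
theorem mFourierCoeff_onCircle_eq_zero_of_ne (X : ShearProfile) (j : d) {q : d → ℤ} {l : d} (hl : l ≠ j) (hq : q l ≠ 0) :
    mFourierCoeff (fun x : UnitAddTorus d => ((X.onCircle (x j) : ℝ) : ℂ)) q = 0 := by
  classical
  have h := mFourierCoeff_comp_eval (G := fun b : UnitAddCircle => ((X.onCircle b : ℝ) : ℂ))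
    (continuous_ofReal.comp X.continuous_onCircle) j q
  rw [if_neg (by push Not; exact ⟨l, hl, hq⟩)] at h
  exact h

/-- **Sobolev–Wiener for a profile read off `x_j`**: `Σ_q |q_j|·‖𝓕(x ↦ X(x_j))(q)‖ ≤ D₂/(4π√3)` whenever `|X″| ≤ D₂`, with the
summability. [cite: Grafakos2014, Prop. 3.1.2 (5) and Prop. 3.2.7 (3)] -/
theorem tsum_abs_mul_norm_mFourierCoeff_onCircle_le (X : ShearProfile) (j : d) {D₂ : ℝ}
    (hD₂ : ∀ y, |iteratedDeriv 2 X y| ≤ D₂) :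
    (Summable fun q : d → ℤ => |(q j : ℝ)| * ‖mFourierCoeff (fun x : UnitAddTorus d => ((X.onCircle (x j) : ℝ) : ℂ)) q‖) ∧
    ∑' q : d → ℤ, |(q j : ℝ)| * ‖mFourierCoeff (fun x : UnitAddTorus d => ((X.onCircle (x j) : ℝ) : ℂ)) q‖ ≤
      D₂ / (4 * Real.pi * Real.sqrt 3) := by
  classical
  -- the derivative family `f α = (X⁽α⁾ : ℂ)`
  have hXc : ContDiff ℝ ∞ (fun y => (X y : ℂ)) := ofRealCLM.contDiff.comp X.contDiff
  have hp0 : Function.Periodic (fun y => (X y : ℂ)) 1 := fun y => by simp only [X.periodic y]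
  have hp : ∀ α, Function.Periodic (iteratedDeriv α (fun y => (X y : ℂ))) 1 := fun α => periodic_iteratedDeriv hp0 α
  have hd : ∀ α y, HasDerivAt (iteratedDeriv α (fun y => (X y : ℂ))) (iteratedDeriv (α + 1) (fun y => (X y : ℂ)) y) y := by
    intro α y
    have hdiff : Differentiable ℝ (iteratedDeriv α (fun y => (X y : ℂ))) := by
      rw [iteratedDeriv_eq_iterate]; exact (hXc.iterate_deriv α).differentiable (by simp)
    rw [iteratedDeriv_succ]
    exact (hdiff y).hasDerivAt
  have hc : ∀ α, Continuous (iteratedDeriv α (fun y => (X y : ℂ))) := fun α => by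
    rw [iteratedDeriv_eq_iterate]; exact (hXc.iterate_deriv α).continuous
  set Θ : ℕ → UnitAddTorus d → ℂ := fun α x => ((hp α).lift : UnitAddCircle → ℂ) (x j) with hΘ
  have hrel : ∀ α q, mFourierCoeff (Θ α) q = (2 * Real.pi * I * (q j : ℂ)) ^ α * mFourierCoeff (Θ 0) q :=
    fun α q => mFourierCoeff_comp_eval_periodicLift_iterate hp hd hc j α q
  have hΘ0 : Θ 0 = fun x : UnitAddTorus d => ((X.onCircle (x j) : ℝ) : ℂ) := by
    funext x
    exact periodicLift_ofReal_eq_onCircle X (hp 0) (fun y => by rw [iteratedDeriv_zero]) (x j)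
  have haxis : ∀ (q : d → ℤ) (l : d), l ≠ j → q l ≠ 0 → mFourierCoeff (Θ 0) q = 0 := by
    intro q l hl hq; rw [hΘ0]; exact mFourierCoeff_onCircle_eq_zero_of_ne X j hl hq
  have hΘ2c : Continuous (Θ 2) :=
    (isSmooth_comp_eval_periodicLift (hp 2) (by rw [iteratedDeriv_eq_iterate]; exact hXc.iterate_deriv 2) j).continuous
  have hB : ∀ x, ‖Θ 2 x‖ ≤ D₂ := fun x => by
    simp only [hΘ]
    refine norm_comp_eval_periodicLift_le (hp 2) (fun y => ?_) j x
    rw [norm_iteratedDeriv_ofReal_comp X.contDiff 2 y]; exact hD₂ y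
  have h := tsum_abs_mul_norm_mFourierCoeff_le j hrel haxis hΘ2c hB
  rwa [hΘ0] at h

/-! ## Lattice moduli from fibrewise Lipschitz bounds -/

omit [Fintype d] [DecidableEq d] in
/-- **From a fibre derivative bound to a fibrewise Lipschitz bound**: if for every `k` the real function `t ↦ Mf k t`
(the fibre profile through `k`) is differentiable with `|∂_t Mf k t| ≤ ω₁` and interpolates the symbol along the axis,
`μ (k − q) = Mf k (k_j − q_j)` for `q` supported on `{j}`, then `|μ k − μ (k − q)| ≤ ω₁|q_j|`. [folklore] -/
theorem abs_sub_le_of_fibre_deriv {μ : (d → ℤ) → ℝ} (j : d) {Mf : (d → ℤ) → ℝ → ℝ} {ω₁ : ℝ}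
    (hdiff : ∀ k, Differentiable ℝ (Mf k)) (hder : ∀ k t, |deriv (Mf k) t| ≤ ω₁)
    (hμ : ∀ k q : d → ℤ, (∀ l, l ≠ j → q l = 0) → μ (k - q) = Mf k ((k j : ℝ) - (q j : ℝ)))
    (k q : d → ℤ) (hq : ∀ l, l ≠ j → q l = 0) : |μ k - μ (k - q)| ≤ ω₁ * |(q j : ℝ)| := by
  have h0 : μ k = Mf k (k j : ℝ) := by
    have := hμ k 0 (fun l _ => rfl)
    simpa using this
  rw [h0, hμ k q hq]
  have h := Convex.norm_image_sub_le_of_norm_deriv_le (f := Mf k) (s := Set.univ) (fun x _ => (hdiff k).differentiableAt)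
    (fun x _ => by rw [Real.norm_eq_abs]; exact hder k x) convex_univ (Set.mem_univ ((k j : ℝ) - (q j : ℝ)))
    (Set.mem_univ (k j : ℝ))
  rw [Real.norm_eq_abs, Real.norm_eq_abs, show (k j : ℝ) - ((k j : ℝ) - (q j : ℝ)) = (q j : ℝ) by ring] at h
  exact h

/-- **The lattice modulus of a fibrewise-Lipschitz bounded symbol**: if `|μ| ≤ M₀` and
`|μ k − μ (k − q)| ≤ ω₁|q_j|` for `q` on the `e_j`-axis, then `ω(q) = ω₁|q_j|` (axis) / `2M₀` (off-axis) is a modulus: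
`0 ≤ ω` and `|μ k − μ (k − q)| ≤ ω q` for all `k, q` — the hypotheses `hω0`, `hω` (`hω20`, `hω2` for `m²`) of
`ledger_step_H_of_moduli`. [folklore] -/
theorem modulus_of_fibre_lipschitz {μ : (d → ℤ) → ℝ} (j : d) {M₀ ω₁ : ℝ} (hω₁ : 0 ≤ ω₁) (hM₀ : ∀ k, |μ k| ≤ M₀)
    (hLip : ∀ k q : d → ℤ, (∀ l, l ≠ j → q l = 0) → |μ k - μ (k - q)| ≤ ω₁ * |(q j : ℝ)|) :
    (∀ q : d → ℤ, 0 ≤ (if (∀ l, l ≠ j → q l = 0) then ω₁ * |(q j : ℝ)| else 2 * M₀)) ∧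
    ∀ k q : d → ℤ, |μ k - μ (k - q)| ≤ (if (∀ l, l ≠ j → q l = 0) then ω₁ * |(q j : ℝ)| else 2 * M₀) := by
  have hM : 0 ≤ M₀ := (abs_nonneg _).trans (hM₀ 0)
  refine ⟨fun q => by split_ifs <;> positivity, fun k q => ?_⟩
  split_ifs with hq
  · exact hLip k q hq
  · calc |μ k - μ (k - q)| ≤ |μ k| + |μ (k - q)| := abs_sub _ _
      _ ≤ M₀ + M₀ := add_le_add (hM₀ _) (hM₀ _)
      _ = 2 * M₀ := by ring

/-- **The spectral moment of a profile against a fibrewise modulus**: with `ω` as in `modulus_of_fibre_lipschitz` and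
`|X″| ≤ D₂`, `q ↦ ω(q)‖𝓕(x ↦ X(x_j))(q)‖` is summable and `Σ_q ω(q)‖𝓕(x ↦ X(x_j))(q)‖ ≤ ω₁·D₂/(4π√3)` (off the axis the
coefficients vanish). [cite: Grafakos2014, Prop. 3.1.2 (5) and Prop. 3.2.7 (3)] -/
theorem tsum_modulus_mul_norm_mFourierCoeff_onCircle_le (X : ShearProfile) (j : d) {M₀ ω₁ D₂ : ℝ} (hω₁ : 0 ≤ ω₁)
    (hD₂ : ∀ y, |iteratedDeriv 2 X y| ≤ D₂) :
    (Summable fun q : d → ℤ => (if (∀ l, l ≠ j → q l = 0) then ω₁ * |(q j : ℝ)| else 2 * M₀) *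
      ‖mFourierCoeff (fun x : UnitAddTorus d => ((X.onCircle (x j) : ℝ) : ℂ)) q‖) ∧
    ∑' q : d → ℤ, (if (∀ l, l ≠ j → q l = 0) then ω₁ * |(q j : ℝ)| else 2 * M₀) *
      ‖mFourierCoeff (fun x : UnitAddTorus d => ((X.onCircle (x j) : ℝ) : ℂ)) q‖ ≤ ω₁ * (D₂ / (4 * Real.pi * Real.sqrt 3)) := by
  classical
  obtain ⟨hs, hle⟩ := tsum_abs_mul_norm_mFourierCoeff_onCircle_le X j hD₂
  have heq : (fun q : d → ℤ => (if (∀ l, l ≠ j → q l = 0) then ω₁ * |(q j : ℝ)| else 2 * M₀) *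
      ‖mFourierCoeff (fun x : UnitAddTorus d => ((X.onCircle (x j) : ℝ) : ℂ)) q‖) =
      fun q => ω₁ * (|(q j : ℝ)| * ‖mFourierCoeff (fun x : UnitAddTorus d => ((X.onCircle (x j) : ℝ) : ℂ)) q‖) := by
    funext q
    split_ifs with hq
    · ring
    · push Not at hq
      obtain ⟨l, hl, hql⟩ := hq
      rw [mFourierCoeff_onCircle_eq_zero_of_ne X j hl hql, norm_zero, mul_zero, mul_zero, mul_zero]
  rw [heq]
  exact ⟨hs.mul_left ω₁, by rw [tsum_mul_left]; exact mul_le_mul_of_nonneg_left hle hω₁⟩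

/-- The carrier `X⁺ + X⁻` read off `x_j` is the profile of the sum: pointwise identity for the LedgerGlue term
`Σ ω₂‖𝓕(x ↦ (X⁺(x_j) + X⁻(x_j) : ℂ))‖`. [folklore] -/
theorem onCircle_add (Xp Xm : ShearProfile) (b : UnitAddCircle) :
    Xp.onCircle b + Xm.onCircle b = (⟨fun y => Xp y + Xm y, fun y => by simp only [Xp.periodic y, Xm.periodic y],
      Xp.contDiff.add Xm.contDiff⟩ : ShearProfile).onCircle b := by
  induction b using QuotientAddGroup.induction_on with
  | H y => simp only [ShearProfile.onCircle_coe]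


/-! ## Appended: the order-`r` Sobolev–Wiener bound (the remainder weight `W_r` from `r + 1` derivatives) -/

omit [DecidableEq d] in
/-- **Sobolev–Wiener inequality on one axis, order `r ≥ 1`.**  Let `Θ_α : T^d → ℂ` satisfy
`𝓕Θ_α(q) = (2πi q_j)^α 𝓕Θ_0(q)`, with `𝓕Θ_0` supported on the `e_j`-axis, `Θ_{r+1}` continuous and `‖Θ_{r+1}‖ ≤ B`.  Then
`q ↦ |q_j|^r·‖𝓕Θ_0(q)‖` is summable and `Σ_q |q_j|^r·‖𝓕Θ_0(q)‖ ≤ B/(2√3·(2π)^r)` — the remainder weight `W_r` of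
`…SlotExpansion` from ONE derivative beyond the order (compare `…SlotWienerBound.tsum_pow_mul_norm_mFourierCoeff_le`:
`B_{r+2}/(12(2π)^r)` from two). [cite: Grafakos2014, Prop. 3.1.2 (5) and Prop. 3.2.7 (3)] -/
theorem tsum_pow_abs_mul_norm_mFourierCoeff_le {Θ : ℕ → UnitAddTorus d → ℂ} (j : d) {r : ℕ} (hr : 1 ≤ r)
    (hrel : ∀ α q, mFourierCoeff (Θ α) q = (2 * Real.pi * I * (q j : ℂ)) ^ α * mFourierCoeff (Θ 0) q)
    (haxis : ∀ (q : d → ℤ) (l : d), l ≠ j → q l ≠ 0 → mFourierCoeff (Θ 0) q = 0) (hΘr : Continuous (Θ (r + 1)))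
    {B : ℝ} (hB : ∀ x, ‖Θ (r + 1) x‖ ≤ B) :
    (Summable fun q : d → ℤ => |(q j : ℝ)| ^ r * ‖mFourierCoeff (Θ 0) q‖) ∧
    ∑' q : d → ℤ, |(q j : ℝ)| ^ r * ‖mFourierCoeff (Θ 0) q‖ ≤ B / (2 * Real.sqrt 3 * (2 * Real.pi) ^ r) := by
  classical
  have hB0 : 0 ≤ B := (norm_nonneg _).trans (hB 0)
  have h2π : 0 < 2 * Real.pi := by positivity
  have hPars := hasSum_sq_mFourierCoeff_of_continuous hΘr
  have hL2 : ∫ x, ‖Θ (r + 1) x‖ ^ 2 ≤ B ^ 2 := by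
    have h := integral_mono_of_nonneg (μ := (volume : Measure (UnitAddTorus d))) (f := fun x => ‖Θ (r + 1) x‖ ^ 2)
      (g := fun _ => B ^ 2) (Eventually.of_forall fun x => by positivity) (integrable_const _)
      (Eventually.of_forall fun x => pow_le_pow_left₀ (norm_nonneg _) (hB x) 2)
    simpa using h
  set ρ : (d → ℤ) → ℝ := fun q => (2 * Real.pi) ^ (r + 1) * (|(q j : ℝ)| ^ r * ‖mFourierCoeff (Θ 0) q‖) with hρ
  set f : (d → ℤ) → ℝ := fun q => if (∀ l, l ≠ j → q l = 0) then 1 / ((q j : ℝ)) ^ 2 else 0 with hf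
  set g : (d → ℤ) → ℝ := fun q => ‖mFourierCoeff (Θ (r + 1)) q‖ ^ 2 with hg
  have hρ0 : ∀ q, 0 ≤ ρ q := fun q => by positivity
  have hf0 : ∀ q, 0 ≤ f q := fun q => by rw [hf]; simp only; split_ifs <;> positivity
  have hg0 : ∀ q, 0 ≤ g q := fun q => by positivity
  have hinj : Function.Injective (fun m : ℤ => (Pi.single j m : d → ℤ)) := fun a b h => by simpa using congrFun h j
  have hsupp : Function.support f ⊆ Set.range (fun m : ℤ => (Pi.single j m : d → ℤ)) := by
    intro q hq
    rw [Function.mem_support, hf] at hq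
    simp only [ne_eq, ite_eq_right_iff, Classical.not_imp] at hq
    refine ⟨q j, ?_⟩
    funext l
    by_cases hl : l = j
    · subst hl; simp
    · show (Pi.single j (q j) : d → ℤ) l = q l
      rw [Pi.single_eq_of_ne (M := fun _ : d => ℤ) hl, hq.1 l hl]
  have hcomp : (f ∘ fun m : ℤ => (Pi.single j m : d → ℤ)) = fun m : ℤ => (1 : ℝ) / (m : ℝ) ^ 2 := by
    funext m
    simp only [Function.comp_apply, hf, Pi.single_eq_same]
    rw [if_pos (show ∀ l : d, l ≠ j → (Pi.single j m : d → ℤ) l = 0 from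
      fun l hl => Pi.single_eq_of_ne (M := fun _ : d => ℤ) hl m)]
  have hsupp' : ∀ x, x ∉ Set.range (fun m : ℤ => (Pi.single j m : d → ℤ)) → f x = 0 := fun x hx =>
    Function.notMem_support.mp fun h => hx (hsupp h)
  have hfs : Summable f := (hinj.summable_iff hsupp').mp (by rw [hcomp]; exact hasSum_one_div_int_sq.summable)
  have hfsum : ∑' q, f q = Real.pi ^ 2 / 3 := by
    rw [← hinj.tsum_eq hsupp, show (fun m : ℤ => f (Pi.single j m)) = f ∘ fun m : ℤ => (Pi.single j m : d → ℤ) from rfl,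
      hcomp, hasSum_one_div_int_sq.tsum_eq]
  have hρfg : ∀ q, ρ q ^ 2 ≤ f q * g q := by
    intro q
    by_cases hq : ∀ l, l ≠ j → q l = 0
    · by_cases hqj : q j = 0
      · have : ρ q = 0 := by rw [hρ]; simp [hqj, zero_pow (by omega : r ≠ 0)]
        rw [this]; simpa using mul_nonneg (hf0 q) (hg0 q)
      · have hne : (2 * Real.pi * I * (q j : ℂ)) ^ (r + 1) ≠ 0 := by
          apply pow_ne_zero; simp [Real.pi_ne_zero, Complex.I_ne_zero, hqj]
        have heq : mFourierCoeff (Θ 0) q = mFourierCoeff (Θ (r + 1)) q / (2 * Real.pi * I * (q j : ℂ)) ^ (r + 1) := by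
          rw [hrel (r + 1) q, mul_div_cancel_left₀ _ hne]
        have hn : ‖(2 * Real.pi * I * (q j : ℂ))‖ = 2 * Real.pi * |(q j : ℝ)| := by
          rw [norm_mul, norm_mul, norm_mul, Complex.norm_I, mul_one, Complex.norm_intCast, Complex.norm_real,
            Complex.norm_ofNat, Real.norm_eq_abs, abs_of_pos Real.pi_pos]
        have hqpos : 0 < |(q j : ℝ)| := abs_pos.mpr (by exact_mod_cast hqj)
        have hρq : ρ q = ‖mFourierCoeff (Θ (r + 1)) q‖ / |(q j : ℝ)| := by
          rw [hρ]; simp only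
          rw [heq, norm_div, norm_pow, hn]
          field_simp
          ring
        rw [hρq, hg]
        simp only [hf, if_pos hq, div_pow, sq_abs, one_div]
        exact le_of_eq (by ring)
    · push Not at hq
      obtain ⟨l, hl, hql⟩ := hq
      have : ρ q = 0 := by rw [hρ]; simp [haxis q l hl hql]
      rw [this]; simpa using mul_nonneg (hf0 q) (hg0 q)
  obtain ⟨hρs, hCS⟩ := tsum_sq_le_tsum_mul_tsum hρ0 hf0 hg0 hfs hPars.summable hρfg
  rw [hfsum, hPars.tsum_eq] at hCS
  have hsum_ρ : ∑' q, ρ q ≤ Real.pi * B / Real.sqrt 3 := by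
    have h3 : 0 < Real.sqrt 3 := Real.sqrt_pos.mpr (by norm_num)
    have hsq : (∑' q, ρ q) ^ 2 ≤ (Real.pi * B / Real.sqrt 3) ^ 2 := by
      calc (∑' q, ρ q) ^ 2 ≤ Real.pi ^ 2 / 3 * ∫ x, ‖Θ (r + 1) x‖ ^ 2 := hCS
        _ ≤ Real.pi ^ 2 / 3 * B ^ 2 := mul_le_mul_of_nonneg_left hL2 (by positivity)
        _ = (Real.pi * B / Real.sqrt 3) ^ 2 := by
            rw [div_pow, mul_pow, Real.sq_sqrt (by norm_num : (0 : ℝ) ≤ 3)]; ring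
    exact (pow_le_pow_iff_left₀ (tsum_nonneg hρ0) (by positivity) two_ne_zero).mp hsq
  have hscale : (fun q : d → ℤ => |(q j : ℝ)| ^ r * ‖mFourierCoeff (Θ 0) q‖) = fun q => ((2 * Real.pi) ^ (r + 1))⁻¹ * ρ q := by
    funext q; rw [hρ]; simp only; field_simp
  rw [hscale]
  refine ⟨hρs.mul_left _, ?_⟩
  rw [tsum_mul_left]
  have h3 : 0 < Real.sqrt 3 := Real.sqrt_pos.mpr (by norm_num)
  calc ((2 * Real.pi) ^ (r + 1))⁻¹ * ∑' q, ρ q ≤ ((2 * Real.pi) ^ (r + 1))⁻¹ * (Real.pi * B / Real.sqrt 3) :=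
        mul_le_mul_of_nonneg_left hsum_ρ (by positivity)
    _ = B / (2 * Real.sqrt 3 * (2 * Real.pi) ^ r) := by rw [pow_succ]; field_simp

end Summit.AnomalousDissipation.AnomalousDissipation.Theorems.SawtoothPulseCascade.K1Slot
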